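import Mathlib
import Summits.NavierStokesRegularity.NavierStokesRegularity.Theorems.TaoLadderRungTwoFlatHopBootstrap
import Summits.NavierStokesRegularity.NavierStokesRegularity.Theorems.TaoLadderRungTwoFlatNearHopStart
import HarnessLib

/-!
# The NEAR-ZONE HOP OF THE FLAT TUBE, CLOSED: `NearClause (n+1)` from pulse data and schedule inequalities only
  (helper for the K_A♭ parent item stmt-NavierStokesRegularity-22987 `FlatGapCertificatesV2`, child 1A `MirrorSolitaryWaveA`
  (flat tube, clause (WG)) and child 2A of route TaoLadderRungTwoFlat; cell harvest/h2-tao-ladder, p1 g22; LADDER §49.5,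
  §52.4 (A52-1), HopTube `TubeStepNear`)

`…NearHop.near_hop_of_globalSols` reduces the near clause of `H(n+1)` to a-priori inputs `A` (block amplitude), `M`
(template on the block), `r` (core deviation above the block), `V₀`, `R_T` and one budget; `…HopBootstrap.hop_apriori_flat`
produces the a-priori package along two global flat solutions by continuous induction. This file composes them:

* `MirrorPulse.hop_apriori_flat_bounds` — the bootstrap's conclusions re-read as the INPUTS of the zone theorems: for
  every `t ∈ [0, τ₁]`, the core gauge deviation `≤ R⋆` at every site, the deviation amplitude `≤ A` on the block
  neighbourhood `[a−1, e+2]`, besides `V(t) ≤ b₁` and `|u_{0,e+1}(t)| ≤ b₂`;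
* `HopTube.near_hop_flat_closed` — **for the FLAT tube (`ε₀ = 0`, hop flow = a global solution `X`, reference = the
  pulse `Φ` at scale `1`): `NearClause P i₀ u⋆ (n+1) (recentre X τ₁ a)` from the pulse data (`M`, `2E`, tail `η_blk`,
  window energy `E_W`), the initial data (`B`, `V₀`, `|u_{0,−K}(0)|`), the bootstrap levels and closing conditions of
  `hop_apriori_flat`, the template landing residual `R_T` and ONE budget inequality** — no free a-priori hypothesis is left
  in `TubeStepNear` for the flat tube.

HONEST FRAMING: a conditional finite-time estimate about a MODEL lattice (Tao 2016 §4 vocabulary on `S♭`, flat clocks);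
every constant is a HYPOTHESIS tied by explicit inequalities; nothing certified; no item closed; nothing about the
Navier–Stokes equations.
-/

noncomputable section

-- the sub-problem namespace repeats the summit name by design (D-0017)
set_option linter.dupNamespace false

namespace Summit.NavierStokesRegularity.NavierStokesRegularity.Theorems

open Set Filter Literature.Analysis.FluidPDE Literature.Analysis.FluidPDE.TaoCascade QuadPolar
open scoped Topology

namespace MirrorPulse

/-- **THE BOOTSTRAP'S OUTPUTS AS ZONE INPUTS.** Under the hypotheses of `hop_apriori_flat`, for every `t ∈ [0, τ₁]`:
the core gauge deviation is `≤ R⋆` at every site, the deviation amplitude is `≤ A` on `[a−1, e+2]`, `V(t) ≤ b₁` and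
`|u_{0,e+1}(t)| ≤ b₂`. [cite: Tao2016AveragedNS, §4 Lemma 4.1 (4.3), (4.8), §6.3–6.4 (statement shape); route TaoLadderRungTwoFlat, LADDER §49.5 (per-hop a-priori package)] -/
theorem hop_apriori_flat_bounds {ε : ℝ} {Φ X : Fin 2 → ℤ → ℝ → ℝ} (hΦ : IsGlobalSol ε Φ) (hX : IsGlobalSol ε X)
    (hε : 0 ≤ ε) {M E : ℝ} (hΦb : ∀ i n t, |Φ i n t| ≤ M) (hXb : ∀ i n t, |X i n t| ≤ M)
    (hEn : ∀ (t : ℝ) (S : Finset ℤ), ∑ n ∈ S, ∑ i : Fin 2, X i n t ^ 2 ≤ 2 * E)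
    {a e : ℤ} (hae : a ≤ e) (W : Finset ℤ) (hW : ∀ n ∈ W, e + 3 ≤ n)
    {g b θ σ τ₁ : ℝ} (hg : 1 ≤ g) (hb : 1 ≤ b) (hθ : 0 ≤ θ) (hτ₁ : 0 ≤ τ₁) (hσ : 0 ≤ σ) (hστ : σ * τ₁ ≤ 1)
    {ηblk : ℝ} (hηblk0 : 0 ≤ ηblk)
    (hΦblk : ∀ i, ∀ n ∈ Finset.Icc (a - 1) (e + 2), ∀ t ∈ Icc 0 τ₁, |Φ i n t| ≤ ηblk)
    {EW : ℝ} (hEW : ∀ t ∈ Icc 0 τ₁, EW ≤ ∑ n ∈ W, ∑ i : Fin 2, Φ i n t ^ 2)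
    {B V₀ : ℝ} (hB : ∀ i k, geomGauge g b i k * |truncFam e (X - Φ) i k 0| ≤ B)
    (hV₀ : coMovingEnergyOn (Finset.Icc a (e + 1)) θ ((e : ℝ) + 1) (X - Φ) 0 ≤ V₀)
    {a₁ b₁ a₂ b₂ ωW Rstar A r₁ μ : ℝ} (hab₁ : b₁ < a₁) (hab₂ : b₂ < a₂)
    (hV₀b : V₀ ≤ b₁) (hr0b : |(X - Φ) 0 (e + 1) 0| ≤ b₂)
    (hωW0 : 0 < ωW) (hωW : ∀ i, ∀ n ∈ W, ωW ≤ geomGauge g b i n)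
    (hRstar : (B + (geomGauge g b 0 (e + 1) * (Real.sqrt (2 * Real.exp (2 * θ) * a₁) *
                  (2 * ηblk + Real.sqrt (2 * Real.exp (2 * θ) * a₁) + ε * (ηblk + a₂)))
              + geomGauge g b 1 e * (a₂ * (ηblk + ε * (2 * ηblk + a₂)))) * τ₁)
            * Real.exp (2 * tableAbsSum shiftSetFlat (mirrorTable ε ε) * M * max g b * τ₁) ≤ Rstar)
    (hC2 : Rstar ≤ geomGauge g b 0 (e + 1) * b₂)
    (hr₁ : Rstar ≤ geomGauge g b 0 (e + 2) * r₁) (hr₁A : r₁ ≤ A)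
    (hAJB : Real.sqrt (2 * E - (max 0 (Real.sqrt EW - Rstar / ωW * Real.sqrt (2 * (W.card : ℝ)))) ^ 2)
              + ηblk ≤ A)
    (hμ : 0 < μ) (hμle : μ ≤ σ * θ - 2 * (1 + ε) * 1 * (A * Real.sinh (θ / 2) + ηblk * (3 + Real.exp θ)))
    (hC1 : V₀ + (Real.exp (θ * ((a : ℝ) - ((e : ℝ) + 1))) * ((1 + ε) * 1 * A ^ 2 * (A + ηblk))
                  + (1 + ε) * 1 * r₁ * (A ^ 2 + ηblk * r₁)) / μ ≤ b₁)
    {t : ℝ} (ht : t ∈ Icc 0 τ₁) :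
    (∀ (i : Fin 2) (k : ℤ), geomGauge g b i k * |truncFam e (X - Φ) i k t| ≤ Rstar) ∧
      (∀ i, ∀ n ∈ Finset.Icc (a - 1) (e + 2), |(X - Φ) i n t| ≤ A) ∧
      coMovingEnergyOn (Finset.Icc a (e + 1)) θ ((e : ℝ) + 1 + σ * t) (X - Φ) t ≤ b₁ ∧
      |(X - Φ) 0 (e + 1) t| ≤ b₂ := by
  have hres := hop_apriori_flat hΦ hX hε hΦb hXb hEn hae W hW hg hb hθ hτ₁ hσ hστ hηblk0 hΦblk hEW hB hV₀ hab₁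
    hab₂ hV₀b hr0b hωW0 hωW hRstar hC2 hr₁ hr₁A hAJB hμ hμle hC1
  have htτ : t ≤ τ₁ := ht.2
  -- signs
  have hωpos : ∀ j n, 0 < geomGauge g b j n := fun j n => geomGauge_pos (by linarith) (by linarith) j n
  have hb₂0 : 0 ≤ b₂ := (abs_nonneg _).trans hr0b
  have ha₂0 : 0 ≤ a₂ := hb₂0.trans hab₂.le
  have hqbar0 : 0 ≤ Real.sqrt (2 * Real.exp (2 * θ) * a₁) := Real.sqrt_nonneg _
  have hB0 : 0 ≤ B := le_trans (mul_nonneg (hωpos 0 0).le (abs_nonneg _)) (hB 0 0)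
  have hF0 : 0 ≤ geomGauge g b 0 (e + 1) * (Real.sqrt (2 * Real.exp (2 * θ) * a₁) *
        (2 * ηblk + Real.sqrt (2 * Real.exp (2 * θ) * a₁) + ε * (ηblk + a₂)))
      + geomGauge g b 1 e * (a₂ * (ηblk + ε * (2 * ηblk + a₂))) := by
    have h1 := (hωpos 0 (e + 1)).le
    have h2 := (hωpos 1 e).le
    positivity
  have hM0 : 0 ≤ M := (abs_nonneg _).trans (hΦb 0 0 0)
  have hL0 : 0 ≤ 2 * tableAbsSum shiftSetFlat (mirrorTable ε ε) * M * max g b := by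
    have := tableAbsSum_nonneg shiftSetFlat (mirrorTable ε ε)
    have : 0 ≤ max g b := le_trans (by linarith) (le_max_left g b)
    positivity
  have hRstar0 : 0 ≤ Rstar := le_trans (mul_nonneg (by positivity) (Real.exp_pos _).le) hRstar
  have hmono : ∀ {B' F' L' s' τ' : ℝ}, 0 ≤ B' → 0 ≤ F' → 0 ≤ L' → 0 ≤ s' → s' ≤ τ' →
      (B' + F' * s') * Real.exp (L' * s') ≤ (B' + F' * τ') * Real.exp (L' * τ') := by
    intro B' F' L' s' τ' hB' hF' hL' hs' hsτ
    have h1 : B' + F' * s' ≤ B' + F' * τ' := by linarith [mul_le_mul_of_nonneg_left hsτ hF']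
    have h2 : Real.exp (L' * s') ≤ Real.exp (L' * τ') := Real.exp_le_exp.mpr (mul_le_mul_of_nonneg_left hsτ hL')
    have h3 : 0 ≤ B' + F' * τ' := by nlinarith
    exact mul_le_mul h1 h2 (Real.exp_pos _).le h3
  -- (a) near edge amplitude on [0, t] from `V ≤ b₁ ≤ a₁`
  have hedge : e ∈ Finset.Icc a (e + 1) := by rw [Finset.mem_Icc]; exact ⟨hae, by omega⟩
  have hq : ∀ s ∈ Icc 0 t, |(X - Φ) 1 e s| ≤ Real.sqrt (2 * Real.exp (2 * θ) * a₁) := by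
    intro s hs
    have hVs : coMovingEnergyOn (Finset.Icc a (e + 1)) θ ((e : ℝ) + 1 + σ * s) (X - Φ) s ≤ a₁ :=
      ((hres s ⟨hs.1, hs.2.trans htτ⟩).1).trans hab₁.le
    have h1 := abs_behind_le_of_coMovingEnergyOn (Finset.Icc a (e + 1)) θ ((e : ℝ) + 1 + σ * s) (X - Φ) s hedge 1
    refine h1.trans (Real.sqrt_le_sqrt ?_)
    have hσs : σ * s ≤ 1 := le_trans (mul_le_mul_of_nonneg_left (hs.2.trans htτ) hσ) hστ
    have hw : Real.exp (θ * ((e : ℝ) + 1 + σ * s - (e : ℝ))) ≤ Real.exp (2 * θ) := by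
      have hθσ : θ * (σ * s) ≤ θ * 1 := mul_le_mul_of_nonneg_left hσs hθ
      exact Real.exp_le_exp.mpr (by linarith)
    have hVs0 : 0 ≤ coMovingEnergyOn (Finset.Icc a (e + 1)) θ ((e : ℝ) + 1 + σ * s) (X - Φ) s :=
      coMovingEnergyOn_nonneg _ _ _ _ _
    have := mul_le_mul hw hVs hVs0 (Real.exp_pos _).le
    linarith
  -- (b) core gauge deviation on [0, t] from `r ≤ b₂ ≤ a₂`
  have hrs : ∀ s ∈ Icc 0 t, |(X - Φ) 0 (e + 1) s| ≤ a₂ := fun s hs =>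
    ((hres s ⟨hs.1, hs.2.trans htτ⟩).2).trans hab₂.le
  have hΦe : ∀ s ∈ Icc 0 t, |Φ 1 e s| ≤ ηblk := fun s hs =>
    hΦblk 1 e (by rw [Finset.mem_Icc]; omega) s ⟨hs.1, hs.2.trans htτ⟩
  have hΦe1 : ∀ s ∈ Icc 0 t, |Φ 0 (e + 1) s| ≤ ηblk := fun s hs =>
    hΦblk 0 (e + 1) (by rw [Finset.mem_Icc]; omega) s ⟨hs.1, hs.2.trans htτ⟩
  have hcore : ∀ (i : Fin 2) (k : ℤ), ∀ s ∈ Icc 0 t,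
      geomGauge g b i k * |truncFam e (X - Φ) i k s| ≤ Rstar := by
    intro i k s hs
    have h := core_apriori_flat (T := t) hΦ hX hε hΦb hXb hg hb hB hΦe hΦe1 hηblk0 hq hqbar0 hrs ha₂0 i k hs
    exact h.trans ((hmono hB0 hF0 hL0 hs.1 (hs.2.trans htτ)).trans hRstar)
  -- (d) sup-closeness on `W` and the amplitude outside it
  have hdevW : ∀ i, ∀ n ∈ W, |X i n t - Φ i n t| ≤ Rstar / ωW := by
    intro i n hn
    have hk : e + 1 ≤ n := by have := hW n hn; omega
    have h := hcore i n t ⟨ht.1, le_rfl⟩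
    rw [truncFam_of_le hk] at h
    rw [le_div_iff₀ hωW0]
    have e1 : (X - Φ) i n t = X i n t - Φ i n t := by simp
    calc |X i n t - Φ i n t| * ωW = ωW * |(X - Φ) i n t| := by rw [e1]; ring
      _ ≤ geomGauge g b i n * |(X - Φ) i n t| := mul_le_mul_of_nonneg_right (hωW i n hn) (abs_nonneg _)
      _ ≤ Rstar := h
  have hamp : ∀ i, ∀ n ∈ Finset.Icc (a - 1) (e + 2), |(X - Φ) i n t| ≤ A := by
    intro i n hn
    have hnW : n ∉ W := by
      intro hnW
      have := hW n hnW
      rw [Finset.mem_Icc] at hn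
      omega
    have hδ0 : 0 ≤ Rstar / ωW := div_nonneg hRstar0 hωW0.le
    have hX' := abs_le_of_energy_budget (z := fun i n => X i n t) (φ := fun i n => Φ i n t) W (hEn t) hδ0
      hdevW hnW i
    have hXA : |X i n t|
        ≤ Real.sqrt (2 * E - (max 0 (Real.sqrt EW - Rstar / ωW * Real.sqrt (2 * (W.card : ℝ)))) ^ 2) :=
      hX'.trans (junkBound_mono (hEW t ht))
    have hΦA : |Φ i n t| ≤ ηblk := hΦblk i n hn t ht
    have htri : |(X - Φ) i n t| ≤ |X i n t| + |Φ i n t| := by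
      have e1 : (X - Φ) i n t = X i n t - Φ i n t := by simp
      rw [e1]; exact abs_sub _ _
    linarith
  exact ⟨fun i k => hcore i k t ⟨ht.1, le_rfl⟩, hamp, (hres t ht).1, (hres t ht).2⟩

end MirrorPulse

namespace HopTube

open MirrorPulse

/-- **THE NEAR-ZONE HOP OF THE FLAT TUBE, CLOSED.** Flat lattice (`ε₀ = 0`), hop flow a global solution `X`, reference
the pulse `Φ` at scale `1`; frame constants `K = P.K`, `D = P.D` (`D ≥ K + 2`), near weight `θ = P.θV`, core gauge
`geomGauge P.g P.b`, pulse window `W ⊆ [2−K, ∞)`; one shell per hop (`στ₁ = 1`); re-centring ratio `a > 0`. Then the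
pulse data (`M`, `2E`, `η_blk`, `E_W`), the initial data (`B`, `V₀`, `|u_{0,−K}(0)| ≤ b₂`), the bootstrap levels and closing
conditions of `hop_apriori_flat`, the template landing residual `R_T` and the budget
`(√(e^{−μτ₁}V₀ + Ē(1 − e^{−μτ₁})/μ) + √R_T)² ≤ a²·v(n+1)`, `Ē = e^{θ(1−D+K)}(1+ε)A²(A+η_blk) + (1+ε)r₁(A² + η_blk r₁)`, give
the near clause of `H(n+1)` for `recentre X τ₁ a`.
[cite: Tao2016AveragedNS, §4 Lemma 4.1 (4.3), (4.8), §6.3–6.4 (statement shape of the checkpoint step); route TaoLadderRungTwoFlat, `HopTube.TubeStepNear` for the flat tube (LADDER §49.5, §52.4 A52-1)] -/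
theorem near_hop_flat_closed (P : TubeSchedule) {ε : ℝ} {Φ X : Fin 2 → ℤ → ℝ → ℝ} {i₀ : Fin 2}
    {ustar : Fin 2 → ℤ → ℝ} (hΦ : IsGlobalSol ε Φ) (hX : IsGlobalSol ε X)
    (hε : 0 ≤ ε) {M E : ℝ} (hΦb : ∀ i n t, |Φ i n t| ≤ M) (hXb : ∀ i n t, |X i n t| ≤ M)
    (hEn : ∀ (t : ℝ) (S : Finset ℤ), ∑ n ∈ S, ∑ i : Fin 2, X i n t ^ 2 ≤ 2 * E)
    (hDK : P.K + 2 ≤ P.D) (W : Finset ℤ) (hW : ∀ n ∈ W, 2 - (P.K : ℤ) ≤ n)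
    (hg : 1 ≤ P.g) (hb : 1 ≤ P.b) (hθ : 0 ≤ P.θV) {σ τ₁ a : ℝ} (hτ₁ : 0 < τ₁) (hσ : 0 ≤ σ) (hστ : σ * τ₁ = 1)
    (ha : 0 < a) {ηblk : ℝ} (hηblk0 : 0 ≤ ηblk)
    (hΦblk : ∀ i, ∀ n ∈ Finset.Icc (-(P.D : ℤ)) (1 - (P.K : ℤ)), ∀ t ∈ Icc 0 τ₁, |Φ i n t| ≤ ηblk)
    {EW : ℝ} (hEW : ∀ t ∈ Icc 0 τ₁, EW ≤ ∑ n ∈ W, ∑ i : Fin 2, Φ i n t ^ 2)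
    {B V₀ : ℝ} (hB : ∀ i k, geomGauge P.g P.b i k * |truncFam (-(P.K : ℤ) - 1) (X - Φ) i k 0| ≤ B)
    (hV₀ : coMovingEnergyOn (Finset.Icc (1 - (P.D : ℤ)) (-(P.K : ℤ))) P.θV (-(P.K : ℝ)) (X - Φ) 0 ≤ V₀)
    {a₁ b₁ a₂ b₂ ωW Rstar A r₁ μ RT : ℝ} {n : ℕ} (hab₁ : b₁ < a₁) (hab₂ : b₂ < a₂)
    (hV₀b : V₀ ≤ b₁) (hr0b : |(X - Φ) 0 (-(P.K : ℤ)) 0| ≤ b₂)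
    (hωW0 : 0 < ωW) (hωW : ∀ i, ∀ n ∈ W, ωW ≤ geomGauge P.g P.b i n)
    (hRstar : (B + (geomGauge P.g P.b 0 (-(P.K : ℤ)) * (Real.sqrt (2 * Real.exp (2 * P.θV) * a₁) *
                  (2 * ηblk + Real.sqrt (2 * Real.exp (2 * P.θV) * a₁) + ε * (ηblk + a₂)))
              + geomGauge P.g P.b 1 (-(P.K : ℤ) - 1) * (a₂ * (ηblk + ε * (2 * ηblk + a₂)))) * τ₁)
            * Real.exp (2 * tableAbsSum shiftSetFlat (mirrorTable ε ε) * M * max P.g P.b * τ₁) ≤ Rstar)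
    (hC2 : Rstar ≤ geomGauge P.g P.b 0 (-(P.K : ℤ)) * b₂)
    (hr₁ : Rstar ≤ geomGauge P.g P.b 0 (1 - (P.K : ℤ)) * r₁) (hr₁A : r₁ ≤ A)
    (hAJB : Real.sqrt (2 * E - (max 0 (Real.sqrt EW - Rstar / ωW * Real.sqrt (2 * (W.card : ℝ)))) ^ 2)
              + ηblk ≤ A)
    (hμ : 0 < μ)
    (hμle : μ ≤ σ * P.θV - 2 * (1 + ε) * 1 * (A * Real.sinh (P.θV / 2) + ηblk * (3 + Real.exp P.θV)))
    (hC1 : V₀ + (Real.exp (P.θV * ((1 : ℝ) - P.D + P.K)) * ((1 + ε) * 1 * A ^ 2 * (A + ηblk))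
                  + (1 + ε) * 1 * r₁ * (A ^ 2 + ηblk * r₁)) / μ ≤ b₁)
    (hR : ∑ k ∈ Finset.Icc (-(P.D : ℤ)) (-(P.K : ℤ) - 1), Real.exp (P.θV * ((k : ℝ) + P.K)) *
        ∑ i : Fin 2, (Φ i (1 + k) τ₁ - |X i₀ 1 τ₁| / P.Astar * ustar i k) ^ 2 / 2 ≤ RT)
    (hbudget : (Real.sqrt (Real.exp (-μ * τ₁) * V₀ +
        (Real.exp (P.θV * ((1 : ℝ) - P.D + P.K)) * ((1 + ε) * 1 * A ^ 2 * (A + ηblk)) + (1 + ε) * 1 * r₁ * (A ^ 2 + ηblk * r₁))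
          * (1 - Real.exp (-μ * τ₁)) / μ) + Real.sqrt RT) ^ 2 ≤ a ^ 2 * P.v (n + 1)) :
    NearClause P i₀ ustar (n + 1) (recentre X τ₁ a) := by
  -- the frame's block in the edge parametrisation: a_blk = 1 − D, e = −K − 1
  have hae : (1 - (P.D : ℤ)) ≤ -(P.K : ℤ) - 1 := by
    have : ((P.K + 2 : ℕ) : ℤ) ≤ (P.D : ℤ) := by exact_mod_cast hDK
    push_cast at this; omega
  have hW' : ∀ m ∈ W, (-(P.K : ℤ) - 1) + 3 ≤ m := fun m hm => by have := hW m hm; omega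
  have i1 : (1 - (P.D : ℤ) - 1) = -(P.D : ℤ) := by ring
  have i2 : (-(P.K : ℤ) - 1 + 2) = 1 - (P.K : ℤ) := by ring
  have i3 : (-(P.K : ℤ) - 1 + 1) = -(P.K : ℤ) := by ring
  have r3 : (((-(P.K : ℤ) - 1 : ℤ)) : ℝ) + 1 = -(P.K : ℝ) := by push_cast; ring
  have r4 : (((1 - (P.D : ℤ) : ℤ)) : ℝ) - ((((-(P.K : ℤ) - 1 : ℤ)) : ℝ) + 1) = (1 : ℝ) - P.D + P.K := by
    push_cast; ring
  have hΦblk' : ∀ i, ∀ m ∈ Finset.Icc (1 - (P.D : ℤ) - 1) (-(P.K : ℤ) - 1 + 2), ∀ t ∈ Icc 0 τ₁,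
      |Φ i m t| ≤ ηblk := by rw [i1, i2]; exact hΦblk
  have hV₀' : coMovingEnergyOn (Finset.Icc (1 - (P.D : ℤ)) (-(P.K : ℤ) - 1 + 1)) P.θV
      ((((-(P.K : ℤ) - 1 : ℤ)) : ℝ) + 1) (X - Φ) 0 ≤ V₀ := by rw [i3, r3]; exact hV₀
  have hr0b' : |(X - Φ) 0 (-(P.K : ℤ) - 1 + 1) 0| ≤ b₂ := by rw [i3]; exact hr0b
  have hRstar' : (B + (geomGauge P.g P.b 0 (-(P.K : ℤ) - 1 + 1) * (Real.sqrt (2 * Real.exp (2 * P.θV) * a₁) *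
                  (2 * ηblk + Real.sqrt (2 * Real.exp (2 * P.θV) * a₁) + ε * (ηblk + a₂)))
              + geomGauge P.g P.b 1 (-(P.K : ℤ) - 1) * (a₂ * (ηblk + ε * (2 * ηblk + a₂)))) * τ₁)
            * Real.exp (2 * tableAbsSum shiftSetFlat (mirrorTable ε ε) * M * max P.g P.b * τ₁) ≤ Rstar := by
    rw [i3]; exact hRstar
  have hC2' : Rstar ≤ geomGauge P.g P.b 0 (-(P.K : ℤ) - 1 + 1) * b₂ := by rw [i3]; exact hC2
  have hr₁' : Rstar ≤ geomGauge P.g P.b 0 (-(P.K : ℤ) - 1 + 2) * r₁ := by rw [i2]; exact hr₁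
  have hC1' : V₀ + (Real.exp (P.θV * ((((1 - (P.D : ℤ) : ℤ)) : ℝ) - ((((-(P.K : ℤ) - 1 : ℤ)) : ℝ) + 1)))
        * ((1 + ε) * 1 * A ^ 2 * (A + ηblk)) + (1 + ε) * 1 * r₁ * (A ^ 2 + ηblk * r₁)) / μ ≤ b₁ := by
    rw [r4]; exact hC1
  have hστ' : σ * τ₁ ≤ 1 := hστ.le
  -- the a-priori package along the hop
  have hpack : ∀ t ∈ Icc 0 τ₁,
      (∀ (i : Fin 2) (k : ℤ), geomGauge P.g P.b i k * |truncFam (-(P.K : ℤ) - 1) (X - Φ) i k t| ≤ Rstar) ∧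
        (∀ i, ∀ m ∈ Finset.Icc (1 - (P.D : ℤ) - 1) (-(P.K : ℤ) - 1 + 2), |(X - Φ) i m t| ≤ A) ∧
        coMovingEnergyOn (Finset.Icc (1 - (P.D : ℤ)) (-(P.K : ℤ) - 1 + 1)) P.θV
            ((((-(P.K : ℤ) - 1 : ℤ)) : ℝ) + 1 + σ * t) (X - Φ) t ≤ b₁ ∧
        |(X - Φ) 0 (-(P.K : ℤ) - 1 + 1) t| ≤ b₂ :=
    fun t ht => hop_apriori_flat_bounds hΦ hX hε hΦb hXb hEn hae W hW' hg hb hθ hτ₁.le hσ hστ' hηblk0 hΦblk' hEW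
      hB hV₀' hab₁ hab₂ hV₀b hr0b' hωW0 hωW hRstar' hC2' hr₁' hr₁A hAJB hμ hμle hC1' ht
  -- feed the near-zone hop along the two global solutions
  have hωpos : ∀ j m, 0 < geomGauge P.g P.b j m := fun j m => geomGauge_pos (by linarith) (by linarith) j m
  have hA : ∀ t ∈ Ioo 0 τ₁, ∀ i, ∀ m ∈ Finset.Icc (-(P.D : ℤ)) (1 - (P.K : ℤ)), |(X - Φ) i m t| ≤ A := by
    intro t ht i m hm
    have h := (hpack t ⟨ht.1.le, ht.2.le⟩).2.1 i m
    rw [i1, i2] at h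
    exact h hm
  have hMb : ∀ t ∈ Ioo 0 τ₁, ∀ i, ∀ m ∈ Finset.Icc (-(P.D : ℤ)) (1 - (P.K : ℤ)), |Φ i m t| ≤ ηblk :=
    fun t ht i m hm => hΦblk i m hm t ⟨ht.1.le, ht.2.le⟩
  have hr : ∀ t ∈ Ioo 0 τ₁, |(X - Φ) 0 (1 - (P.K : ℤ)) t| ≤ r₁ := by
    intro t ht
    have h := (hpack t ⟨ht.1.le, ht.2.le⟩).1 0 (1 - (P.K : ℤ))
    rw [truncFam_of_le (by omega)] at h
    exact le_of_mul_le_mul_left (h.trans hr₁) (hωpos 0 _)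
  have hDK' : P.K + 1 ≤ P.D := by omega
  -- the edge input by amplitudes (as in `near_hop_of_pseudoFlows_amp`)
  have hE : ∀ t ∈ Ioo 0 τ₁,
      Real.exp (P.θV * (((1 - (P.D : ℤ) : ℤ) : ℝ) - (-(P.K : ℝ) + σ * t))) * |fluxT ε 0 (X - Φ) (1 - (P.D : ℤ) - 1) t|
        + Real.exp (P.θV * (((-(P.K : ℤ) : ℤ) : ℝ) - (-(P.K : ℝ) + σ * t))) * |fluxT ε 0 (X - Φ) (-(P.K : ℤ)) t|
        + (1 + ε) * 1 * ηblk *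
          (Real.exp (P.θV * (((1 - (P.D : ℤ) : ℤ) : ℝ) - (-(P.K : ℝ) + σ * t))) * (X - Φ) 1 (1 - (P.D : ℤ) - 1) t ^ 2
            + Real.exp (P.θV * (((-(P.K : ℤ) : ℤ) : ℝ) - (-(P.K : ℝ) + σ * t))) * (X - Φ) 0 (-(P.K : ℤ) + 1) t ^ 2)
        ≤ Real.exp (P.θV * ((1 : ℝ) - P.D + P.K)) * ((1 + ε) * 1 * A ^ 2 * (A + ηblk))
          + (1 + ε) * 1 * r₁ * (A ^ 2 + ηblk * r₁) := by
    intro t ht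
    have hσt : 0 ≤ σ * t := mul_nonneg hσ ht.1.le
    have hqa : |(X - Φ) 1 (1 - (P.D : ℤ) - 1) t| ≤ A := hA t ht 1 _ (by simp only [Finset.mem_Icc]; omega)
    have hpa : |(X - Φ) 0 (1 - (P.D : ℤ)) t| ≤ A := hA t ht 0 _ (by simp only [Finset.mem_Icc]; omega)
    have hqP : |(X - Φ) 1 (-(P.K : ℤ)) t| ≤ A := hA t ht 1 _ (by simp only [Finset.mem_Icc]; omega)
    have hr' : |(X - Φ) 0 (-(P.K : ℤ) + 1) t| ≤ r₁ := by
      have e : (-(P.K : ℤ) + 1) = 1 - (P.K : ℤ) := by ring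
      rw [e]; exact hr t ht
    have hPne : (((-(P.K : ℤ)) : ℤ) : ℝ) ≤ -(P.K : ℝ) + σ * t := by push_cast; linarith
    have hc1 : ∀ m : ℤ, clock 0 m ≤ 1 := fun m => by unfold clock; simp
    have hedge := edgeInput_le (θ := P.θV) (ne := -(P.K : ℝ) + σ * t) hε (by norm_num) hθ hηblk0 (X - Φ) t hPne
      hqa hpa hqP hr' hr₁A (hc1 _) (hc1 _)
    refine hedge.trans ?_
    have hr₁0 : 0 ≤ r₁ := (abs_nonneg _).trans (hr t ht)
    have hA0 : 0 ≤ A := hr₁0.trans hr₁A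
    have hX0 : 0 ≤ (1 + ε) * 1 * A ^ 2 * (A + ηblk) := by positivity
    have hw : Real.exp (P.θV * ((((1 - (P.D : ℤ)) : ℤ) : ℝ) - (-(P.K : ℝ) + σ * t)))
        ≤ Real.exp (P.θV * ((1 : ℝ) - P.D + P.K)) := by
      refine Real.exp_le_exp.mpr (mul_le_mul_of_nonneg_left ?_ hθ)
      push_cast; linarith
    exact add_le_add_left (mul_le_mul_of_nonneg_right hw hX0) _
  exact near_hop_of_globalSols P hΦ hX hε hθ hDK' hτ₁ hστ ha hA hMb hE hμ hμle hV₀ hR hbudget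

end HopTube

end Summit.NavierStokesRegularity.NavierStokesRegularity.Theorems

end
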